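import Mathlib
import Summits.AtomisticToContinuum.Crystallization.Theorems.GappedShellCensusCleanLimitsHaveWindowsLaminarDefs

/-!
# The laminar defect is Lipschitz in the cluster

Stub `stub_laminarDefectLipschitz` (R3a) of the skeleton `Lines/Sketch.lean` of the crux
`GappedShellCensus.CleanLimitsHaveWindows` (stmt-AtomisticToContinuum-15932), lead
prover-line-stmt-AtomisticToContinuum-15932-c3-0; vocabulary (`bondShell`, `laminarSlotC`, `laminarSlotH`,
`posMisfit`, `laminarDefect`) from `GappedShellCensusCleanLimitsHaveWindows(Laminar)Defs`.

**Statement.** For `a > 0` there is `K` (depending only on `a`) such that, whenever the bond shells of `p` in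
`Z` and of `p'` in `Z'` correspond by a bijection `f` moving relative positions by at most `ε ∈ [0, a]`, the
laminar defects satisfy `|laminarDefect a Z p - laminarDefect a Z' p'| ≤ K ε`.

**Proof.** The pattern of the landed `stub_defectLipschitz`, with one new point: the slot parameters
`θ = (u, v, w₁, w₂)` range over the non-compact `(ℝ³)⁴`, so the two position misfits are NOT uniformly close in
`θ`; the comparison is made at almost optimal parameters only.
1. Re-indexing: `e ↦ f⁻¹ ∘ e` maps the labellings `↥(bondShell a Z p) ≃ Fin 12` ONTO the labellings of the
   shell of `p'` (`Function.Surjective.iInf_comp`), so both defects are infima over the same index types.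
2. A priori bound (`ll_laminarDefect_le`): testing the zero slot model `θ = 0` gives
   `laminarDefect a Z p ≤ Σ_k ‖q k − p‖² ≤ 12 (a (1 + 1/50))² =: M` (shell points are within `a (1 + 1/50)`
   of the centre); an empty labelling type gives the junk `0`.
3. One-sided stability of infima at almost-optimal indices (`ll_iInf_le_iInf_add`): if `⨅ u ≤ M` and
   `v i ≤ u i + C` whenever `u i ≤ M + 1`, then `⨅ v ≤ ⨅ u + C`; applied twice (labellings, then parameters),
   it reduces the claim `laminarDefect a Z' p' ≤ laminarDefect a Z p + C` to the pointwise estimate at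
   parameters where the position misfit of the `Z`-cluster is `≤ M + 2`.
4. Pointwise (`ll_posMisfit_le_add`): if `posMisfit p q slot ≤ N` then every residual has norm `≤ √N`, the
   matched residual differs by `≤ ε`, so `‖r'‖² ≤ (‖r‖ + ε)² ≤ ‖r‖² + ε (2 √N + ε)` and, summing the twelve
   labels, `posMisfit p' q' slot ≤ posMisfit p q slot + 12 ε (2 √N + ε) ≤ … + 12 ε (2 √(M + 2) + a)`.
5. Symmetry (`f.symm`) gives the other inequality; `K := 12 (2 √(12 (a (1 + 1/50))² + 2) + a)`.

No new definitions.
-/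

noncomputable section

namespace Summit.AtomisticToContinuum.Crystallization.Theorems.CleanHull

open Literature.MathematicalPhysics.StatisticalMechanics

/-! ## An order lemma -/

/-- One-sided stability of infima of non-negative real families at almost-optimal indices: if `⨅ u ≤ M` and
`v i ≤ u i + C` at every index with `u i ≤ M + 1`, then `⨅ v ≤ ⨅ u + C` (for an empty index both infima are
the junk `0`, whence the hypothesis `0 ≤ C`). [folklore] -/
theorem ll_iInf_le_iInf_add {ι : Sort*} {u v : ι → ℝ} {M C : ℝ} (hC : 0 ≤ C) (hv : ∀ i, 0 ≤ v i)
    (hM : ⨅ i, u i ≤ M) (h : ∀ i, u i ≤ M + 1 → v i ≤ u i + C) : ⨅ i, v i ≤ (⨅ i, u i) + C := by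
  rcases isEmpty_or_nonempty ι with hι | hι
  · simp [hC]
  have hbv : BddBelow (Set.range v) := ⟨0, by rintro _ ⟨i, rfl⟩; exact hv i⟩
  refine le_of_forall_pos_lt_add fun η hη => ?_
  have hη' : 0 < min η 1 := lt_min hη one_pos
  obtain ⟨i, hi⟩ := exists_lt_of_ciInf_lt (lt_add_of_pos_right (⨅ i, u i) hη')
  have h1 : u i ≤ M + 1 := by linarith [min_le_right η 1]
  have h2 := h i h1
  have h3 := ciInf_le hbv i
  linarith [min_le_left η 1]

/-! ## Pointwise stability of the position misfit -/

/-- One squared residual: if `‖r‖² ≤ N` and `‖r' − r‖ ≤ ε` (`ε ≥ 0`) then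
`‖r'‖² ≤ (‖r‖ + ε)² ≤ ‖r‖² + ε (2 √N + ε)`. [folklore] -/
theorem ll_sq_norm_le_add {r r' : EuclideanSpace ℝ (Fin 3)} {ε N : ℝ} (hε : 0 ≤ ε) (hN : ‖r‖ ^ 2 ≤ N)
    (h : ‖r' - r‖ ≤ ε) : ‖r'‖ ^ 2 ≤ ‖r‖ ^ 2 + ε * (2 * √N + ε) := by
  have h1 : ‖r‖ ≤ √N := by
    have := Real.abs_le_sqrt hN
    rwa [abs_of_nonneg (norm_nonneg _)] at this
  have h2 : ‖r'‖ ≤ ‖r‖ + ε :=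
    calc ‖r'‖ = ‖r + (r' - r)‖ := by congr 1; abel
      _ ≤ ‖r‖ + ‖r' - r‖ := norm_add_le _ _
      _ ≤ ‖r‖ + ε := by linarith
  have h3 : ‖r'‖ ^ 2 ≤ (‖r‖ + ε) ^ 2 := pow_le_pow_left₀ (norm_nonneg _) h2 2
  nlinarith [h3, h1, hε, norm_nonneg r, mul_le_mul_of_nonneg_left h1 hε]

/-- **Pointwise stability of the position misfit at bounded misfit.** If `posMisfit p q slot ≤ N` and the
relative positions of the two labelled clusters differ label by label by `≤ ε`, then
`posMisfit p' q' slot ≤ posMisfit p q slot + 12 ε (2 √N + ε)` (same slot model). [folklore] -/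
theorem ll_posMisfit_le_add {p p' : EuclideanSpace ℝ (Fin 3)} {q q' slot : Fin 12 → EuclideanSpace ℝ (Fin 3)}
    {ε N : ℝ} (hε : 0 ≤ ε) (hN : posMisfit p q slot ≤ N) (hq : ∀ k, dist (q' k - p') (q k - p) ≤ ε) :
    posMisfit p' q' slot ≤ posMisfit p q slot + 12 * (ε * (2 * √N + ε)) := by
  have hN' : ∑ l : Fin 12, ‖q l - p - slot l‖ ^ 2 ≤ N := hN
  have hk : ∀ k, ‖q' k - p' - slot k‖ ^ 2 ≤ ‖q k - p - slot k‖ ^ 2 + ε * (2 * √N + ε) := by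
    intro k
    refine ll_sq_norm_le_add hε ?_ ?_
    · exact (Finset.single_le_sum (fun l _ => sq_nonneg ‖q l - p - slot l‖) (Finset.mem_univ k)).trans hN'
    · have e1 : q' k - p' - slot k - (q k - p - slot k) = (q' k - p') - (q k - p) := by abel
      rw [e1, ← dist_eq_norm]
      exact hq k
  calc posMisfit p' q' slot = ∑ k : Fin 12, ‖q' k - p' - slot k‖ ^ 2 := rfl
    _ ≤ ∑ k : Fin 12, (‖q k - p - slot k‖ ^ 2 + ε * (2 * √N + ε)) := Finset.sum_le_sum fun k _ => hk k
    _ = posMisfit p q slot + 12 * (ε * (2 * √N + ε)) := by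
      rw [Finset.sum_add_distrib]
      simp [posMisfit]

/-! ## A priori bound for the laminar defect -/

/-- The cubic slot model with zero parameters is the zero model. [folklore] -/
theorem ll_laminarSlotC_zero : laminarSlotC 0 0 0 0 = 0 := by
  funext k
  fin_cases k <;> simp [laminarSlotC]

/-- **A priori bound.** `laminarDefect a Z p ≤ 12 (a (1 + 1/50))²`: test any labelling against the zero slot
model (`θ = 0`), every shell point being within `a (1 + 1/50)` of the centre; an empty labelling type gives the
junk `0`. [folklore] -/
theorem ll_laminarDefect_le (a : ℝ) (Z : Set (EuclideanSpace ℝ (Fin 3))) (p : EuclideanSpace ℝ (Fin 3)) :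
    laminarDefect a Z p ≤ 12 * (a * (1 + 1 / 50)) ^ 2 := by
  rcases isEmpty_or_nonempty (↥(bondShell a Z p) ≃ Fin 12) with hL | ⟨⟨e⟩⟩
  · rw [laminarDefect, Real.iInf_of_isEmpty]
    positivity
  unfold laminarDefect
  refine ciInf_le_of_le ⟨0, ?_⟩ e (ciInf_le_of_le ⟨0, ?_⟩
    ((0 : EuclideanSpace ℝ (Fin 3)), (0 : EuclideanSpace ℝ (Fin 3)), (0 : EuclideanSpace ℝ (Fin 3)),
      (0 : EuclideanSpace ℝ (Fin 3))) ?_)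
  · rintro _ ⟨e', rfl⟩
    exact Real.iInf_nonneg fun _ => le_min (posMisfit_nonneg _ _ _) (posMisfit_nonneg _ _ _)
  · rintro _ ⟨θ, rfl⟩
    exact le_min (posMisfit_nonneg _ _ _) (posMisfit_nonneg _ _ _)
  · refine (min_le_left _ _).trans ?_
    dsimp only
    rw [ll_laminarSlotC_zero]
    unfold posMisfit
    calc ∑ k : Fin 12, ‖(e.symm k : EuclideanSpace ℝ (Fin 3)) - p - (0 : Fin 12 → EuclideanSpace ℝ (Fin 3)) k‖ ^ 2
        ≤ ∑ _k : Fin 12, (a * (1 + 1 / 50)) ^ 2 := Finset.sum_le_sum fun k _ => ?_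
      _ = 12 * (a * (1 + 1 / 50)) ^ 2 := by simp
    rw [Pi.zero_apply, sub_zero, ← dist_eq_norm, dist_comm]
    exact pow_le_pow_left₀ dist_nonneg (e.symm k).2.2.2 2

/-! ## The one-sided estimate and the stub -/

/-- **One-sided Lipschitz estimate.** If the bond shells of `p` in `Z` and of `p'` in `Z'` correspond by a
bijection moving relative positions by `≤ ε ≤ a`, then
`laminarDefect a Z' p' ≤ laminarDefect a Z p + 12 (2 √(12 (a (1 + 1/50))² + 2) + a) ε`. [folklore] -/
theorem ll_laminarDefect_le_add {a : ℝ} (ha : 0 < a) {Z Z' : Set (EuclideanSpace ℝ (Fin 3))}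
    {p p' : EuclideanSpace ℝ (Fin 3)} {ε : ℝ} (hε : 0 ≤ ε) (hεa : ε ≤ a)
    (f : ↥(bondShell a Z p) ≃ ↥(bondShell a Z' p'))
    (hf : ∀ w : ↥(bondShell a Z p),
      dist ((f w : EuclideanSpace ℝ (Fin 3)) - p') ((w : EuclideanSpace ℝ (Fin 3)) - p) ≤ ε) :
    laminarDefect a Z' p' ≤
      laminarDefect a Z p + 12 * (2 * √(12 * (a * (1 + 1 / 50)) ^ 2 + 2) + a) * ε := by
  set M : ℝ := 12 * (a * (1 + 1 / 50)) ^ 2 with hM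
  set C : ℝ := 12 * (2 * √(M + 2) + a) * ε with hC
  have hC0 : 0 ≤ C := by positivity
  -- the pointwise step at bounded misfit
  have key : ∀ (e : ↥(bondShell a Z p) ≃ Fin 12) (slot : Fin 12 → EuclideanSpace ℝ (Fin 3)),
      posMisfit p (fun k => (e.symm k : EuclideanSpace ℝ (Fin 3))) slot ≤ M + 2 →
      posMisfit p' (fun k => (f (e.symm k) : EuclideanSpace ℝ (Fin 3))) slot ≤
        posMisfit p (fun k => (e.symm k : EuclideanSpace ℝ (Fin 3))) slot + C := by
    intro e slot hle
    have h1 := ll_posMisfit_le_add (p' := p') (q' := fun k => (f (e.symm k) : EuclideanSpace ℝ (Fin 3)))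
      hε hle fun k => hf (e.symm k)
    have h2 : 12 * (ε * (2 * √(M + 2) + ε)) ≤ C := by
      rw [hC]
      nlinarith [Real.sqrt_nonneg (M + 2), mul_nonneg hε (sub_nonneg.2 hεa)]
    linarith
  -- a priori bound and re-indexing
  have hD : laminarDefect a Z p ≤ M := ll_laminarDefect_le a Z p
  have hsurj : Function.Surjective (fun e : ↥(bondShell a Z p) ≃ Fin 12 => f.symm.trans e) :=
    fun e' => ⟨f.trans e', by ext x; simp⟩
  unfold laminarDefect at hD ⊢
  rw [← hsurj.iInf_comp]
  simp only [Equiv.symm_trans_apply, Equiv.symm_symm]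
  refine ll_iInf_le_iInf_add hC0
    (fun e => Real.iInf_nonneg fun _ => le_min (posMisfit_nonneg _ _ _) (posMisfit_nonneg _ _ _)) hD
    fun e he => ?_
  refine ll_iInf_le_iInf_add hC0 (fun θ => le_min (posMisfit_nonneg _ _ _) (posMisfit_nonneg _ _ _)) le_rfl
    fun θ hθ => ?_
  have hθ2 : min (posMisfit p (fun k => (e.symm k : EuclideanSpace ℝ (Fin 3)))
      (laminarSlotC θ.1 θ.2.1 θ.2.2.1 θ.2.2.2))
      (posMisfit p (fun k => (e.symm k : EuclideanSpace ℝ (Fin 3)))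
      (laminarSlotH θ.1 θ.2.1 θ.2.2.1 θ.2.2.2)) ≤ M + 2 := by
    linarith
  rcases le_total (posMisfit p (fun k => (e.symm k : EuclideanSpace ℝ (Fin 3)))
      (laminarSlotC θ.1 θ.2.1 θ.2.2.1 θ.2.2.2))
    (posMisfit p (fun k => (e.symm k : EuclideanSpace ℝ (Fin 3)))
      (laminarSlotH θ.1 θ.2.1 θ.2.2.1 θ.2.2.2)) with hle | hle
  · rw [min_eq_left hle] at hθ2 ⊢
    exact (min_le_left _ _).trans (key e _ hθ2)
  · rw [min_eq_right hle] at hθ2 ⊢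
    exact (min_le_right _ _).trans (key e _ hθ2)

/-- **Stub R3a (the laminar defect is Lipschitz in the cluster; OPEN, M).** If the bond shells of `p` in `Z` and of `p'` in `Z'`
correspond by a bijection moving relative positions by `≤ ε ≤ a`, the laminar defects differ by `≤ K ε`. Pattern: the landed
`stub_defectLipschitz`, with one new point — the slot parameters range over the NON-COMPACT `(ℝ³)⁴`, so the comparison is made at
`η`-optimal parameters only: there every residual `‖q k − p − slot k‖` is bounded by `√(laminarDefect + η) ≤ √(12 (a(1 + 1/50))² + 1)`
(test the slot `θ = 0`), hence `|posMisfit_Z(θ) − posMisfit_{Z'}(θ)| ≤ 12 ε (2 √(12 (a (1 + 1/50))² + 1) + ε)` and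
`laminarDefect a Z' p' ≤ laminarDefect a Z p + K ε`, symmetrically. (Shells without a `Fin 12` labelling give the junk `0` on both
sides.) Here `K = 12 (2 √(12 (a (1 + 1/50))² + 2) + a)`. [folklore] -/
theorem stub_laminarDefectLipschitz : ∀ a : ℝ, 0 < a → ∃ K : ℝ, ∀ (Z Z' : Set (EuclideanSpace ℝ (Fin 3)))
    (p p' : EuclideanSpace ℝ (Fin 3)) (ε : ℝ), 0 ≤ ε → ε ≤ a →
    (∃ f : ↥(bondShell a Z p) ≃ ↥(bondShell a Z' p'),
      ∀ w : ↥(bondShell a Z p), dist ((f w : EuclideanSpace ℝ (Fin 3)) - p') ((w : EuclideanSpace ℝ (Fin 3)) - p) ≤ ε) →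
    |laminarDefect a Z p - laminarDefect a Z' p'| ≤ K * ε := by
  intro a ha
  refine ⟨12 * (2 * √(12 * (a * (1 + 1 / 50)) ^ 2 + 2) + a), ?_⟩
  rintro Z Z' p p' ε hε hεa ⟨f, hf⟩
  have h1 := ll_laminarDefect_le_add ha hε hεa f hf
  have h2 := ll_laminarDefect_le_add ha hε hεa f.symm fun w' => by
    rw [dist_comm]
    simpa using hf (f.symm w')
  rw [abs_sub_le_iff]
  constructor <;> linarith

end Summit.AtomisticToContinuum.Crystallization.Theorems.CleanHull

end
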